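import Mathlib
import HarnessLib
import HarnessLib.Audit
import Summits.AtomisticToContinuum.Statement
import Literature.Geometry.DiscreteGeometry.KissingPatterns
import Literature.MathematicalPhysics.StatisticalMechanics.BarlowStacking
import Literature.MathematicalPhysics.StatisticalMechanics.HaggStacking
import Literature.MathematicalPhysics.StatisticalMechanics.MiePotential
import HarnessLib.Audit.Status.Attr

/-!
Route: BrittleRungDescent

DORMANT since 2026-08-23T19:59:21Z (reconciler: no traction for 6.2 d (last activity item-evidence-added at 2026-08-17T14:28:43Z); parked, not closed — `ledger route dormant route-AtomisticToContinuum-BrittleRungDescent --off` to reacti) — unstaffed, not closed; items shared with open routes are served there. `ledger route dormant <id> --off` reactivates.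

# Route BrittleRungDescent — brittle rung and descent — Mie (2p,p) crystallization for p ≥ p₀ by
local Hales at radius 2 + Barlow-truss rigidity, then Lennard-Jones through two constants (kernel
tolerance 1/400)

Card realised: brittle-rung-mie-descent (absorbing the energy engine E2 of the retired duplicate
brittle-mie-hales-korn). Conforming successor
(D-0027 §2.1) of the retired route BrittleMieDescent (same planner, 2026-08-15T11:28Z; closed 13:41Z
not-a-thesis; its crux EffectiveLocalHales at
tolerance 1/100 was REFUTED at 13:32Z by the decahedral shell,
Theorems/BrittleMieDescentEffectiveLocalHalesRefutation.lean — lesson built in below).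
Put Lennard-Jones at the end p = 6 of the Mie family V_p(r) = r⁻²ᵖ/(2p) − r⁻ᵖ/p (tree: `miePotential
p`, definitionally `mieWith (1/(2p)) (1/p) (2p) p`; `miePotential 6 = lennardJones`;
well depth 1/(2p), curvature p at r = 1) and run ONE architecture at every p: (G) LOCAL HALES AT
RADIUS 2 — an atom that is softly twelve-kissed
WITH the Hales gap (12 neighbours in [a(1−η), a(1+η)], none in (a(1+η), 1.26a)) and whose twelve
neighbours are likewise, has a first shell whose
soft contact graph IS the fcc or hcp pattern graph (η → 0 limits land in Hales's class 𝒱, so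
Hales2012 Lemmas 9–10 apply; no L12, no
kissing-number theorem, no rate needed); (K) SOFT KISSING a.e. from the energy; (R) BARLOW-TRUSS
RIGIDITY — a ground state whose bond network is
Barlow off o(N) atoms crystallizes exactly (discrete Korn on octet trusses + action–reaction + Hägg
domination select relaxed hcp). It suffices to
show X := X_G ∧ X_K ∧ X_glue ∧ X_R at p = 6 with the explicit tolerance η = 1/400 (below the
decahedral closure threshold η⋆ ≈ 0.0067):
X_G = LocalHalesKernel, X_K = LJBondSpread, X_glue = LJKissingBalls (bookkeeping), X_R =
LJBarlowRigidity; the deciding theorem is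
`closes … : Crystallization := h_R (h_glue h_G h_K)` (pure logic, sorry-free in Sketch.lean). The
BRITTLE RUNG — MieRung: ∃ p₀ ∀ p ≥ p₀ both
Blanc–Lewin conjuncts for V_p, the first off-lattice 3-D crystallization theorem for a pure pair
potential — is the same chain with (G) in
compactness form (SoftLocalHales — since rev 3 stated unconditionally: it follows from
LocalHalesKernel by tolerance monotonicity,
or from Hales 2012 Thm 3 + Lemma 9 by compactness once that computer-assisted fact is PROVED in the
tree; no item of this route takes an
unproved Literature fact as hypothesis or import), (K) = MieSoftKissing, (R) = BrittleBarlowRigidity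
(RungAssembly);
it validates the engine where sphere packing is exact and names the only two p-dependent constants
of the descent: the soft-kissing tolerance
versus the local-Hales threshold (now known to lie below 0.0067), and first- versus second-shell
coordination pricing (crossover p ∈ (7,8)).
Lean: `LocalHalesKernel ∧ LJBondSpread ∧ LJKissingBalls ∧ LJBarlowRigidity`

## Assembly
The deciding theorem is pure logic: `theorem closes (… all items …) : Crystallization :=
h_LJBarlowRigidity (h_LJKissingBalls h_LocalHalesKernel
h_LJBondSpread)` (checked sorry-free in Sketch.lean against `_root_.Crystallization` with all twelve
items as hypotheses, in two binder orders);
the counting/rescaling work lives in the support item LJKissingBalls, the analysis in the four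
LJ-end/rung cruxes. The rung composes the same way
(RungAssembly ⇒ MieRung).

Rationale: WHY THIS LINE. Every crystallization theorem for realistic potentials descends from the brittle
(sticky) limit (HeitmannRadin1980, Theil2006, LucaFriesecke2016
"brittle limit"), and the only 3-D theorem, FlatleyTheil2015 (arXiv:1407.0692, Thm 1.1), needs a
three-body term V₃ whose sole role is local
geometry ("Ψ selects ground states which maximize the number of edges in each nearest neighborhood",
§2.1; Conj. 2.2 printed as the route to drop
it). Observation imported from discrete geometry: Hales's proof of Fejes Tóth's conjecture
(Hales2012, arXiv:1209.6043; tree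
`Hales2012_contactGraphFccOrHcp`, `isKissingConfig_kissingShell`, `HalesDSP_layerPackings_holds`) is
LOCAL at radius two bonds, which is exactly
the form a defect-sparse energy argument can feed, so V₃ is replaced by a theorem plus
Bolzano–Weierstrass; the energy side imports geometric
rigidity (FrieseckeJamesMuller2002-type discrete Korn on the tetrahedron–octahedron truss common to
ALL Barlow stackings) and the 1-D Hägg/ANNNI
stacking calculus already in tree (HaggStacking, BarlowStackingEnergy; items 0716/0737). The
decahedral refutation of the predecessor's kernel is informative: the effective local-Hales
threshold sits BELOW the five-tetrahedra closure strain 0.67 % (TetrahedralFrustration made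
quantitative at the shell level), so the LJ descent needs a bond spread below ~0.3 % — a sharp,
checkable demand on LJ ground states (LJBondSpread). Versus the sibling lines (retired in the D-0027
audit): CrystalKissingRigidity needed a linear-RATE robust Hales — here the local
lemma is rate-free with a combinatorial conclusion and strain is controlled two-sidedly;
SteepnessLadderOneCentre climbs the same (2q,q) ladder
by a one-centre domination inequality (no shell classification, no truss rigidity; its items
3623/3624 are re-filed here over `miePotential`);
TwoCentreKissing traded the other way at the local step (gap-FREE kernel = Flatley–Theil's open
Conj. 2.2) where this route keeps Hales's gap
and pays for the annulus on the energy side; MieLadderVdwKissing is a different ladder ((n,6)).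
Negatives index: one entry bears on this line (EffectiveLocalHales@1/100) and is avoided by
construction. Cone discipline (rev 3): no item names an unproved
Literature fact — Hales's classification enters only through the route's own LocalHalesKernel
(effective) ⊃ SoftLocalHales (qualitative),
the Mie family is written over the light `miePotential` (`miePotential_eq_mieWith` is `rfl`), and
the Theil2006 / Flyspeck–Hales fact files
are cited, not imported.

RANKED CRUXES. #2 BrittleBarlowRigidity (crux) — BARLOW-TRUSS RIGIDITY, brittle regime (card B4 + E2
of brittle-mie-hales-korn; rev 3: V_p = `miePotential p` and η₁ ≤ 1/100, free by tolerance
monotonicity below the gap and needed by RungAssembly — retriage note (a)): there are η₁ ∈ (0,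
1/100] and p₁ such that for every p ≥ p₁, if V_p has ground states for all N and along every
ground-state sequence all but o(N) atoms i have a 4-ball (distances ≤ 4 from x_i) in which EVERY
atom is softly twelve-kissed at scale 1 with tolerance η₁ and gap 1.26 AND has an fcc- or
hcp-pattern soft contact graph on its shell, then HasPeriodicGroundStateEnergy V_p 3 ∧
IsCrystallizing V_p 3. Engine: the bond network off the defect set is a bounded-strain realisation
of a Barlow (tetrahedron–octahedron) truss; cell-wise rigidity + FJM give a discrete Korn inequality
uniform in the Hägg word; expanding Σ V_p around the relaxed stacking, the linear term is a boundary
functional of balanced internal forces (action–reaction, exponentially small in p), so E ≥ N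
e(hcp_p*) + c·#defects + gap·(fault area) − C N^(2/3); with the trial bound E(N) ≤ N e(hcp_p*) + C
N^(2/3) this gives vanishing strain, ≤ K fault planes, hcp windows (CrystallizationLocalLimit
bookkeeping) and attainment of the periodic minimum by relaxed hcp (Hägg domination 0737 with J₂(p)
< 0). [difficulty: XL] (why it might fail: Stacking must be resolved inside finite ground states at
scale |J2(p)| ~ 1.63^-p/p against elastic and surface noise; needs a discrete Korn constant for
Barlow trusses uniform in the Hägg word plus an action-reaction surface estimate, both unproved;
twinned finite-N minimisers (CKL 2023) stress it.) [FlatleyTheil2015, Theil2006,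
FrieseckeJamesMuller2002, arXiv:2204.12892, PartayOrtnerCsanyi2017, stmt-AtomisticToContinuum-0737]
#3 MieSoftKissing (crux) — SOFT KISSING IN THE BRITTLE LIMIT (card B1 = K1_p; same text as item
4143): for every tolerance η ∈ (0, 1/100] there is p₀ such that for all p ≥ p₀, along every sequence
of ground states of V_p the fraction of atoms that are NOT [at distance ≥ 1−η from every other atom,
with exactly twelve others within 1+η and none at distance in (1+η, 1.26)] tends to 0. Inputs: a
soft coordination cap (≤ 12 in the well: Musin–Tarasov's strong thirteen-spheres theorem, a
certified Bachoc–Vallentin-type SDP bound, or the tree's `flyspeck_L12` once PROVED — none imported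
here), tail bounds Σ_(r≥1.2)|V_p| = O(1.2⁻ᵖ/p), relaxed-hcp trial energy; the o(N) conclusion is
where a V₃-free coercive estimate is needed. Used by the rung at η = min(η₀, η₁) ≤ 1/100 — after the
decahedral lesson expect η₀ < 0.0067. [difficulty: XL] (why it might fail: o(N) is not bond
counting: the tail budget leaves a defect DENSITY ~1.26^-p, so o(N) needs a coercive Theil-type
bound without V3; 13-14-coordinated stretched motifs stay competitive at first-shell level until p ~
8 and with outer neighbours until p ~ 40, so p0 may be huge.) [Hales2012, MusinTarasov2012,
FlatleyTheil2015, arXiv:1605.00034, BlancLewin2015]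
#4 LJBarlowRigidity (crux) — BARLOW-TRUSS RIGIDITY AT p = 6 (the descent end of crux 2, explicit
constants): if for some scale a > 0, along every sequence of Lennard-Jones ground states, all but
o(N) atoms have a 4a-ball in which every atom is softly twelve-kissed at scale a with tolerance
1/400 and gap 1.26a and has an fcc/hcp-pattern soft contact graph on its shell, then
`Crystallization` (the sub-problem statement itself, both conjuncts for `lennardJones`). Same engine
as crux 2 with the LJ numbers: J₂ ≈ −7.3e−5 < 0 with Hägg margin ≈ 250–450 (certified J_k: item
0670), octet-truss Korn constant versus the r⁻⁶ tail Hessian; ground states exist and are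
1/3-separated (PROVED `LennardJonesGroundStatesExist_holds` / `LennardJonesMinimalDistance_holds`,
LennardJonesClusters.lean — imported by the Theorems file, not by the route). [deps:
BrittleBarlowRigidity] [difficulty: open-problem] (why it might fail: p = 6 is not brittle: even at
bond spread 1/400 the elastic noise per atom (~2e-5) is of the order of the stacking gap |J2| ~
7e-5, so hcp selection inside finite ground states may fail (fcc/twinned minimisers); the r^-6 tail
is outside every localized class (LocalizedPotentialsExcludeLennardJones).) [FlatleyTheil2015,
FrieseckeJamesMuller2002, PartayOrtnerCsanyi2017, Stillinger2001,
Literature.Barriers.AtomisticToContinuum.ShortRangeStackingBlindness,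
stmt-AtomisticToContinuum-0737]
#5 LJBondSpread (crux) — LJ SOFT KISSING WITH A 0.25 % BOND SPREAD (card B5(a), the p = 6 constant
K1_6, sharpened by the decahedral lesson): there is a scale a > 0 such that along every sequence of
Lennard-Jones ground states the fraction of atoms NOT [at distance ≥ (399/400)a from all others,
exactly twelve within (401/400)a, none in ((401/400)a, 1.26a)] tends to 0. Two-sided (strain)
control that statements 0750 (no lower annulus bound) and TwoCentreKissing's BondOrderTwelve (no
gap) do not give; mechanism: second-shell pricing (card link-census-gauss-bonnet-3d) since one-shell
accounting fails at p = 6, elastic decay away from the o(N) defects, the N^(−1/3) Laplace strain,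
and a relaxed-hcp nearest-neighbour split below 0.5 %. [difficulty: open-problem] (why it might
fail: A 0.25 % bond spread a.e. is false if the relaxed-hcp nearest-neighbour split of LJ exceeds
0.5 % (crude estimate 0.1-0.3 %, uncertified) or if strained five-fold (decahedral, 0.67 %) or
13-coordinated motifs persist in the bulk; needs second-shell pricing as 13 x V(1.0455) beats 12 x
V(1) at p = 6.) [stmt-AtomisticToContinuum-0750, Hales2012, BlancLewin2015,
Literature.Barriers.AtomisticToContinuum.IcosahedralClusters,
Literature.Barriers.AtomisticToContinuum.TetrahedralFrustration, Stillinger2001]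
#6 LocalHalesKernel (crux) — EFFECTIVE LOCAL HALES AT RADIUS 2, TOLERANCE 1/400 (card B5(b), the p =
6 constant η₀; pure metric geometry, scale 1): if u ∈ S ⊂ ℝ³ and every point of S within 401/400 of
u (u and its soft neighbours) is softly twelve-kissed with tolerance 1/400 (all other points at
distance ≥ 399/400, exactly twelve within 401/400, none in (401/400, 1.26)), then the soft contact
graph (pairs within 401/400) on the twelve neighbours of u is isomorphic to the contact graph of the
fcc pattern or of the hcp pattern (tree `fccKissingPattern`/`hcpKissingPattern`, contacts at
distance 1). RESTATEMENT of the refuted EffectiveLocalHales (tolerance 1/100; witness: the D₅ₕ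
decahedral shell, five strained tetrahedra around a bond, which closes iff (2 sin 36°)²((1−η)² −
(1+η)²/4) ≤ (1+η)², i.e. η ≥ η⋆ ≈ 0.0067; at η = 1/400 the left side exceeds the right by 0.023).
The η → 0 version is SoftLocalHales (support, compactness); this is its effectivisation, a
semialgebraic statement checkable Flyspeck-style by mining the margins of Hales's Lemma 9 exclusions
and Lemma 10's rigidity (tree KissingRigidity.lean, TameContactGraphs.lean) together with the
closure inequalities of the strained polytetrahedral families. [difficulty: L] (why it might fail:
Restated below the decahedral threshold eta* = 0.0067 that refuted the 1/100 version (five strained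
tetrahedra round a bond, margin 0.023 at 1/400); another strained polytetrahedral or tame-graph
(Hales Lemma 8) shell might still close with bars in [0.9975, 1.0025] and non-bars >= 1.26 - none
known.) [Hales2012,
Summit.AtomisticToContinuum.Crystallization.Theorems.BrittleMieDescentEffectiveLocalHales_refuted,
KusnerKusnerLagariasShlosman2018, BoroczkySzabo2016, doi:10.1016/j.cam.2013.03.036,
Literature.Barriers.AtomisticToContinuum.TetrahedralFrustration]
#9 SoftLocalHales (support) — SOFT LOCAL HALES (card B2+(3); rev 3: UNCONDITIONAL — the former
hypothesis `Hales2012_contactGraphFccOrHcp` is an unproved computer-assisted Literature fact and is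
neither assumed nor imported): there is η₀ > 0 such that for all η ∈ (0, η₀] the conclusion of
LocalHalesKernel holds with 1/400 replaced by η. Proofs: (i) from LocalHalesKernel with η₀ = 1/400
by bookkeeping — below the gap the dichotomy `≤ 1+η ∨ ≥ 1.26` makes neighbour sets and soft contact
graphs at η and at 1/400 coincide; (ii) stand-alone from Hales 2012 Thm 3 + Lemma 9 (printed for ALL
V ∈ 𝒱, arXiv:1209.6043 pp. 11–13) by compactness — a limit shell of counterexamples with η_n → 0,
doubled, lies in 𝒱 by the GAP hypothesis at u and its neighbours (no L12, no kissing-number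
theorem), so soft contact graphs are eventually fcc/hcp — usable only once the tree fact is PROVED
(`Hales2012_contactGraphTame`), never as a hypothesis. (The decahedral witness shows η₀ < 0.0067.)
[difficulty: provable-now after LocalHalesKernel; XL stand-alone] [Hales2012, FlatleyTheil2015]
#9 SoftLayerPropagation (support) — SOFT LAYER PROPAGATION (qualitative local form of the PROVED
`HalesDSP_layerPackings_holds`; same text as item 4148): for every R ≥ 4 and δ > 0 there is η > 0
such that if every point of S in the R-ball about c is softly twelve-kissed (tolerance η, gap 1.26)
with an fcc/hcp soft contact graph, then S in the R/2-ball is δ-close to a rigid-motion image of a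
Barlow stacking `barlowStacking 1 √(2/3) s`, `IsHaggSeq s`. By compactness from the exact local
statement (LayerPropagation/LayerStackings.lean arguments are local). The effective octet-truss
version rides with the rigidity cruxes (`--supports`). [difficulty: M] [HalesDSP2012, Hales2012]
#9 LJKissingBalls (support) — LJ BOOKKEEPING GLUE (provable now): LocalHalesKernel → LJBondSpread →
[the hypothesis of LJBarlowRigidity]: rescale by a⁻¹; an atom all of whose soft neighbours are
softly kissed gets its fcc/hcp shell graph from LocalHalesKernel; by the PROVED
`LennardJonesMinimalDistance_holds` (δ = 1/3) a 7a-ball holds ≤ C atoms, so the atoms whose 7a-ball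
meets a non-kissed atom number ≤ C·#(non-kissed) = o(N); every other atom has a 4a-ball of kissed
atoms with shell graphs. This item makes the deciding theorem pure logic: `closes … := h_R (h_glue
h_G h_K)`. [difficulty: provable-now] [BlancLewin2015, LennardJonesClusters.lean]
#9 LadderGroundStates (support) — GROUND STATES ON THE (2q,q) LADDER EXIST AND ARE (1 −
2/q)-SEPARATED for q ≥ q₀ — the claim of item stmt-AtomisticToContinuum-3623 written over
`miePotential q` (rev 3, definitionally equal; Blanc–Lewin §1.2 binding criterion as in the tree's
`LennardJonesGroundStatesExist_holds`; Xue/Blanc removal-plus-packing as in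
`LennardJonesMinimalDistance_holds`). RungAssembly consumes existence and separation from it.
[difficulty: M] [BlancLewin2015, stmt-AtomisticToContinuum-3623, LennardJonesClusters.lean]
#9 MieRung (support) — THE BRITTLE RUNG (milestone; card headline; the claim of item
stmt-AtomisticToContinuum-3624 over `miePotential q`, rev 3): there is q₀ such that for all q ≥ q₀,
HasPeriodicGroundStateEnergy V_q 3 ∧ IsCrystallizing V_q 3 — both Blanc–Lewin conjuncts for the Mie
(2q,q) potential in ℝ³, Flatley–Theil without V₃ (conclusion relaxed hcp). Closed here by
RungAssembly; a hypothesis of `closes` like every item, but not used by its proof. [difficulty: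
open-problem] [FlatleyTheil2015, BlancLewin2015, stmt-AtomisticToContinuum-3624, arXiv:2204.12892,
arXiv:2604.19239]
#9 RungAssembly (support) — glue for the rung (rev 3: no Literature hypothesis), `SoftLocalHales →
LadderGroundStates → MieSoftKissing → BrittleBarlowRigidity → MieRung`: SoftLocalHales gives η₀,
BrittleBarlowRigidity gives η₁ ≤ 1/100 and p₁; take η = min(η₀, η₁); MieSoftKissing gives p₀(η);
soft kissing and the shell graphs are monotone in the tolerance below the gap (η ≤ η₁ < 0.26); atoms
whose 7-ball contains a non-kissed atom number ≤ C·#(non-kissed) by packing (separation from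
LadderGroundStates), hence o(N); SoftLocalHales supplies the shell graphs; BrittleBarlowRigidity
applies for p ≥ max(p₀(η), p₁, q₀) with existence from LadderGroundStates. [difficulty:
provable-now] [Hales2012, FlatleyTheil2015]

TWO-LAYER PLAN. Foreseen glued splits (k ≤ 3, depth 1), filed when a crux closes or a prover
proposes: BrittleBarlowRigidity ⇐ BarlowTrussKorn (discrete
Korn uniform in the Hägg word) → ActionReactionSurface (linear term is a boundary functional,
O(1.4⁻²ᵖ·|∂|)) → HaggFaultSelection (0737-type
domination with boundary term ⇒ ≤ K faults, relaxed hcp attains the periodic minimum);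
MieSoftKissing ⇐ MieBondCount (≤ 12 in the well + gap from a PROVED
coordination cap, defect density O(1.26⁻ᵖ)) → MieCoercivity (defects cost ≥ c/p against the sharp
constant); LJBondSpread ⇐ SecondShellPriceList
(card link-census-gauss-bonnet-3d) → LJStrainDecay → HcpSplitBound (relaxed-hcp nearest-neighbour
split < 0.5 %, lattice sums). LocalHalesKernel ⇐
closure inequalities of the strained polytetrahedral families (decahedral done: η⋆ = 0.0067) →
margin mining of the (PROVED, in-tree)
Lemma 9 LPs → second-order rigidity of the centred cuboctahedron / anticuboctahedron.

KILL CRITERIA. LocalHalesKernel refuted again (a 1/400-tolerance configuration with a non-fcc/hcp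
shell graph): if the witness threshold η⋆⋆ still exceeds twice
the relaxed-hcp bond split, restate once more below it; otherwise the descent is dead and the route
shrinks to the rung (close
`refuted:LocalHalesKernel`; the rung items survive as shared statements). LJBondSpread refuted
(positive fraction of LJ bulk atoms outside the
0.25 % spread: certified relaxed-hcp split > 0.5 %, or persistent five-fold/icosahedral order in
large LJ minimisers): the LJ end dies, every
sphere-packing-heritage LJ line with it; keep the rung. MieSoftKissing refuted for all p
(13/14-coordinated bulk phases beating hcp_p at
arbitrarily large p): close the route. BrittleBarlowRigidity refuted (a Barlow-ordered Mie
ground-state sequence with non-vanishing fault density,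
or an aperiodic optimal stacking, i.e. Hägg domination failing for V_p): pivot to fcc/hcp-agnostic
IsCrystallizing via thick fault-free slabs, or
close. SoftLocalHales is a theorem modulo Hales 2012 (Thm 3 and Lemma 9 are printed for all V ∈ 𝒱)
and a corollary of LocalHalesKernel; if a stand-alone proof exposes that tameness needs more than
membership in 𝒱
the whole line rests on Flatley–Theil's open Conjecture 2.2 — close as `refuted:SoftLocalHales`
unless 2.2 is adopted as an explicit
conditional. Crystallization proved by another route moots the LJ end, not the rung.

NOT DECOMPOSED YET. The value of p₀ and of η₁ (now expected < 0.0067); the discrete Korn constant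
and its uniformity in the Hägg word; the action–reaction surface
estimate; relaxed stackings (non-ideal c/a, two bond lengths) and the sign/size of J₂(p)
analytically (Poisson–Bessel card) versus certified
(0670-type); the Wulff/N^(2/3) constants; rotations of fault planes; the periodic-competitor (torus)
version of the rigidity engine; the
second-shell price list at p = 6; the exhaustive list of strained polytetrahedral closure
thresholds. All are layer-2 children of cruxes 2–6 and
wait for LocalHalesKernel to land first (cheap, decisive). Proof-time literature (coordination cap,
Hales's classification) is taken as PROVED facts or certified computations by the lineage that needs
it, never as an item hypothesis.

CHEAPEST FALSIFIER. (1) The refuter's own recipe at 1/400: rerun the decahedral certificate family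
and the other frustrated shells (icosahedral fragment, Z14/Z15
Frank–Kasper caps, the six Hales tame graphs) with bars in [0.9975, 1.0025] and non-bars ≥ 1.26 —
any closure refutes LocalHalesKernel; the
decahedral one provably does not close (margin 0.023). (2) Lattice sums (kit): relax LJ hcp in (a,
c) and read off the nearest-neighbour split s_LJ; s_LJ > 0.5 % kills LJBondSpread as filed — an
UNCERTIFIED run (retriage 2026-08-15: c/a − ideal ≈ −1.4e−4, s_LJ ≈ 1e−4, E_hcp − E_fcc ≈
−7.2e−5/atom) says it will not fire; the binding
risk of LJBondSpread is a.e. twelve-coordination itself. (3) Done at vendoring: Thm 3 / Lemma 9 of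
arXiv:1209.6043 (pp. 11–13) quantify over
all V ∈ 𝒱; SoftLocalHales closes from LocalHalesKernel in one session.

NUMBERS. V_p(1) = −1/(2p), V_p''(1) = p; Hales h₀ = 1.26 (gap radius 63/50 at unit scale);
decahedral closure threshold η⋆ ≈ 0.0067 from
(2 sin 36°)²((1−η)² − (1+η)²/4) = (1+η)² (refuter g42-18; at η = 1/400: 1.0279 vs 1.0050, no
closure; at 1/100: closes); icosahedral shell–shell
stretch 5.15 %; first-shell 13-vs-12 crossover p ∈ (7, 8) (13·V_p(1.0455) vs 12·V_p(1): −0.5120 vs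
−0.5000 at p = 6, −0.3698 vs −0.3750 at p = 8;
card); J₂(p) < 0 for p ∈ [5, 30] with Hägg domination ratio 311 (p=5), 447 (6), 811 (8), 2.4e3 (12),
2.4e4 (20), 6e5 (30) (card's layer sums,
uncertified); LJ: J₂ ≈ −7.3e−5, bulk bond 0.971, second shell 1.373; LJ minimal distance δ = 1/3
(tree). Tolerances filed: η = 1/400, radius 4
(resp. 4a, 7a in the glue). Items at open: 12 (5 cruxes, 6 support of which 2 shared (3623/3624) and
4 re-attached from the predecessor
(4142/4143/4147/4148/4149 texts), 1 assembly). Rev 3 (cone repair): Literature imports 6 → 4, 6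
items restated, 0 unproved
Literature facts named by items.

DEFINITION REQUESTS. None: `miePotential` (MiePotential.lean; `miePotential_six`,
`miePotential_eq_mieWith`), `fccKissingPattern`/`hcpKissingPattern`,
`barlowStacking`, `IsHaggSeq`, `IsGroundState`, `HasPeriodicGroundStateEnergy`, `IsCrystallizing`,
`lennardJones`, `Crystallization` — all exist
(lean search --decl); they are the only project constants the items use.

Novelty: Searches (2026-08-15): `lit frontier AtomisticToContinuum --since 2021` (30 rows; crystallization
rows: none 3-D off-lattice); `lit bridges
AtomisticToContinuum --cross any`; `lit search --source zbmath "crystallization three dimensions"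
--year-from 2010` (12: Mainini–Stefanelli 2014
carbon, Farmer–Esedoglu–Smereka 2017 Brenner, FTTT 2013 doi:10.1016/j.cam.2013.03.036,
Friedrich–Kreutz–Stefanelli arXiv:2509.05642 on-lattice);
`lit search --source crossref "face-centered cubic crystallization atomistic configurations pair
potential without three-body"` (1 relevant:
FlatleyTheil2015); `lit search --hybrid "Lennard-Jones hcp fcc lattice sums c/a"`
(BeterminSamajTravenec2022, CKL 2023); openalex/arXiv/S2
rate-limited, galaxy saturated (logged); plus the card's audit by refuter-12 (65 works citing
arXiv:1407.0692 checked: none removes V₃ or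
proves Conj. 2.2; Kreutz–Ziereis arXiv:2604.19239 and CKL arXiv:2204.12892 status quotes "limited to
two dimensions"); plus the tree's own
negative knowledge (decahedral refutation of the 1/100 kernel, 2026-08-15).
Nearest prior art found: FlatleyTheil2015 (arXiv:1407.0692: 3-D fcc crystallization WITH V₃; Def.
2.1 contains rescaled Mie for large p;
Conj. 2.2; Prop. 3.3 robust local form by compactness from Thm 3.4/3.5) and Hales2012
(arXiv:1209.6043, exact kissing-twelve classification;
tree FejesTothKissingTwelve.lean); 2-D template Theil2006; brittle limit named in LucaFriesecke2016
(arXiv:1605.00034).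
Delta: Flatley–Theil's programme with V  [refs: 10.1016/j.cam.2013.03.036, 2509.05642, 1407.0692, 2604.19239, 2204.12892, 1209.6043, 1605.00034, doi:10.1016/j.cam.2013.03.036, FlatleyTheil2015, BeterminSamajTravenec2022, Hales2012, Theil2006, LucaFriesecke2016]

Barriers (technique_class: brittle-limit-continuation, local-hales, barlow-truss): - technique_class: brittle-limit-continuation, local-hales, barlow-truss
- Literature.Barriers.AtomisticToContinuum.LocalizedPotentialsExcludeLennardJones: APPLIES and is
embraced — p = 6 is outside Theil's and Flatley–Theil's classes (`not_isLocalizedPair_miePotential`,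
for all q < 8; the barrier file is cited, not imported, since rev 3), so no localized-class theorem
is instantiated at p = 6; the rung is proved where the class conditions hold (q = p ≥ 8 passes the
r⁻¹⁰ decay test) and LJ is reached only through the explicit cruxes LJBondSpread / LJBarlowRigidity
/ LocalHalesKernel.
- Literature.Barriers.AtomisticToContinuum.TetrahedralFrustration: APPLIES at the shell level, as
the decahedral refutation shows (five regular tetrahedra around a bond miss closing by 7.36°,
closable at 0.67 % strain); evaded quantitatively: every tolerance in the LJ end is 1/400 < η⋆ =
0.0067, and the qualitative rung uses η → 0; no single-cell density bound is used.
- Literature.Barriers.AtomisticToContinuum.DecahedralSoftShell: APPLIES squarely — LocalHalesKernel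
is in its technique class (one atom and its twelve neighbours, fixed tolerance, gap dichotomy, no
energies); evaded by the barrier's own evasion (i): tolerance 1/400 < η⋆ ≈ 0.0067, where the
five-ring provably does not close (margin 0.023), with the matching 1/400 carried by LJBondSpread /
LJKissingBalls / LJBarlowRigidity; its caveat (b) (other soft shells at smaller tolerance) is
LocalHalesKernel's declared why-might-fail, and the

History (route lifecycle, newest last):
- 2026-08-15T16:32:33Z · rev 3: restated BrittleBarlowRigidity (stmt-AtomisticToContinuum-9204), MieSoftKissing (stmt-AtomisticToContinuum-9205), SoftLocalHales (stmt-AtomisticToContinuum-9209), LadderGroundStates (stmt-AtomisticToContinuum-9212), MieRung (stmt-AtomisticToContinuum-9213), RungAssembly (stmt-AtomisticToContinuum-9214) — cone re (planner-rrepair-AtomisticToContinuum-BrittleRu-5404441a-g2-0)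
- 2026-08-16T15:47:47Z · rev 5: restated Assembly (stmt-AtomisticToContinuum-9215 proved) — route-repair (ground-failed, unit rground-AtomisticToContinuum-BrittleRun-5404441a): the only blocking ground flag is the bookkeeping item Assembly (stmt-Atomis (planner-rground-AtomisticToContinuum-BrittleRun-5404441a-0)
- 2026-08-23T19:59:21Z · DORMANT — reconciler: no traction for 6.2 d (last activity item-evidence-added at 2026-08-17T14:28:43Z); parked, not closed — `ledger route dormant route-AtomisticToConti (operator:999:3594547)

sub-problem: Crystallization · status: dormant · opened planner-plancard-AtomisticToContinuum-Crystal-007228c5-0 2026-08-15T13:52:20Z · rev 5 · ledger route-AtomisticToContinuum-BrittleRungDescent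
GENERATED by the gate from the ledger (D-0016/17). Provers cite these decls: `theorem foo : Summit.AtomisticToContinuum.Crystallization.Theses.BrittleRungDescent.<Decl> := …` in Summits/AtomisticToContinuum/Crystallization/Theorems/<Name>.lean.
-/

namespace Summit.AtomisticToContinuum.Crystallization.Theses.BrittleRungDescent

open scoped BigOperators Topology Manifold Classical MeasureTheory ProbabilityTheory Matrix InnerProductSpace ComplexConjugate ContinuousMap
open Filter Set Function TopologicalSpace MeasureTheory

attribute [summit_statement] _root_.Crystallization

-- earlier BrittleBarlowRigidity (stmt-AtomisticToContinuum-9204, replaced 2026-08-15T16:32:33Z -> stmt-AtomisticToContinuum-10942): retired by None — ∃ η₁ : ℝ, 0 < η₁ ∧ ∃ p₁ : ℕ, ∀ p : ℕ, p₁ ≤ p → (∀ N : ℕ, ∃ y : Fin N → EuclideanSpace ℝ (Fin 3), Literature.MathematicalPhysics.StatisticalMechanics.IsGroundState (Literature.Barriers.AtomisticToContinuum.mieWith (1 / (2 * (p : ℝ))) (1 / (p : ℝ)) (2 * 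
/-- item stmt-AtomisticToContinuum-10942 · crux · rank 2 · open · by planner
why it might fail: Stacking must be selected inside finite ground states at scale |J2(p)|~1.63^-p/p while the sticky Wulff constant prefers fcc at O(N^(2/3)) (12*2^(2/3) vs 3*2^(2/3)*65^(1/3), CKL 2023 (25),(28)); the discrete Korn constant uniform in the Hagg word and the action-reaction surface bound are unproved.
sources: FlatleyTheil2015, Theil2006, FrieseckeJamesMuller2002, arXiv:2204.12892, PartayOrtnerCsanyi2017, stmt-AtomisticToContinuum-0737
[crux] BARLOW-TRUSS RIGIDITY, brittle regime (card B4 + E2 of brittle-mie-hales-korn; rev 3 of the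
text of item 4142/9204: V_p is written as the light `miePotential p` — definitionally `mieWith
(1/(2p)) (1/p) (2p) p`, `miePotential_eq_mieWith` — and the witness tolerance is bounded, η₁ ≤
1/100, which is free by tolerance monotonicity below the gap and is exactly what RungAssembly's
bookkeeping needs, retriage note (a)): there are η₁ ∈ (0, 1/100] and p₁ such that for every p ≥ p₁,
if V_p has ground states for all N and along every ground-state sequence all but o(N) atoms i have a
4-ball (distances ≤ 4 from x_i) in which EVERY atom is softly twelve-kissed at scale 1 with
tolerance η₁ and gap 1.26 AND has an fcc- or hcp-pattern soft contact graph on its shell, then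
HasPeriodicGroundStateEnergy V_p 3 ∧ IsCrystallizing V_p 3. Engine: the bond network off the defect
set is a bounded-strain realisation of a Barlow (tetrahedron–octahedron) truss; cell-wise rigidity +
FJM give a discrete Korn inequality uniform in the Hägg word; expanding Σ V_p around the relaxed
stacking, the linear term is a boundary functional of balanced internal forces (action–reaction,
exponentially small in p), so E -/
@[route_item "route-AtomisticToContinuum-BrittleRungDescent", crux]
def BrittleBarlowRigidity : Prop :=
  ∃ η₁ : ℝ, 0 < η₁ ∧ η₁ ≤ 1 / 100 ∧ ∃ p₁ : ℕ, ∀ p : ℕ, p₁ ≤ p → (∀ N : ℕ, ∃ y : Fin N → EuclideanSpace ℝ (Fin 3), Literature.MathematicalPhysics.StatisticalMechanics.IsGroundState (Literature.MathematicalPhysics.StatisticalMechanics.miePotential p) y) → (∀ x : (N : ℕ) → (Fin N → EuclideanSpace ℝ (Fin 3)), (∀ N, Literature.MathematicalPhysics.StatisticalMechanics.IsGroundState (Literature.MathematicalPhysics.StatisticalMechanics.miePotential p) (x N)) → Filter.Tendsto (fun N : ℕ => (Nat.card {i : Fin N // ¬ ∀ j : Fin N, dist (x N i) (x N j) ≤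 4 → (((∀ l : Fin N, l ≠ j → (1 - η₁) ≤ dist (x N j) (x N l) ∧ (dist (x N j) (x N l) ≤ (1 + η₁) ∨ 63 / 50 ≤ dist (x N j) (x N l))) ∧ Nat.card {l : Fin N // l ≠ j ∧ dist (x N j) (x N l) ≤ (1 + η₁)} = 12) ∧ ((∃ e : {k : Fin N // k ≠ j ∧ dist (x N j) (x N k) ≤ (1 + η₁)} ≃ {q : EuclideanSpace ℝ (Fin 3) // q ∈ Literature.Geometry.DiscreteGeometry.fccKissingPattern}, ∀ k k' : {k : Fin N // k ≠ j ∧ dist (x N j) (x N k) ≤ (1 + η₁)}, k ≠ k' → (dist (x N k.1) (x N k'.1) ≤ (1 + η₁) ↔ dist (e k).1 (e k').1 = 1)) ∨ (∃ e : {k : Fin N // k ≠ j ∧ dist (x N j) (x N k) ≤ (1 + η₁)} ≃ {q : EuclideanSpace ℝ (Fin 3) // q ∈ Literature.Geometry.DiscreteGeometry.hcpKissingPattern}, ∀ k k' : {k : Fin N // k ≠ j ∧ dist (x N j) (x N k) ≤ (1 + η₁)}, k ≠ k' → (dist (x N k.1) (x N k'.1) ≤ (1 + η₁) ↔ dist (e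 k).1 (e k').1 = 1))))} : ℝ) / N) Filter.atTop (nhds 0)) → Literature.MathematicalPhysics.StatisticalMechanics.HasPeriodicGroundStateEnergy (Literature.MathematicalPhysics.StatisticalMechanics.miePotential p) 3 ∧ Literature.MathematicalPhysics.StatisticalMechanics.IsCrystallizing (Literature.MathematicalPhysics.StatisticalMechanics.miePotential p) 3

-- earlier MieSoftKissing (stmt-AtomisticToContinuum-9205, replaced 2026-08-15T16:32:33Z -> stmt-AtomisticToContinuum-10943): retired by None — ∀ η : ℝ, 0 < η → η ≤ 1 / 100 → ∃ p₀ : ℕ, ∀ p : ℕ, p₀ ≤ p → ∀ x : (N : ℕ) → (Fin N → EuclideanSpace ℝ (Fin 3)), (∀ N, Literature.MathematicalPhysics.StatisticalMechanics.IsGroundState (Literature.Barriers.AtomisticToContinuum.mieWith (1 / (2 * (p : ℝ))) (1 / (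
/-- item stmt-AtomisticToContinuum-10943 · crux · rank 3 · open · by planner
why it might fail: o(N) is not bond counting: the tail leaves a defect budget ~1.26^-p*N, so o(N) needs a V3-free coercivity estimate (Flatley-Theil Conj. 2.2 territory, open); 13-coordinated stretched shells beat 12 exact contacts until p~8 and compete via outer shells to p~40, so p0(eta) may be astronomical.
sources: FlatleyTheil2015, Hales2012, MusinTarasov2012, arXiv:1605.00034, BlancLewin2015, Literature.Barriers.AtomisticToContinuum.IcosahedralClusters
[crux] SOFT KISSING IN THE BRITTLE LIMIT (card B1 = K1_p; rev 3 of the text of item 4143/9205: V_p =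
`miePotential p`, definitionally the old `mieWith` term): for every tolerance η ∈ (0, 1/100] there
is p₀ such that for all p ≥ p₀, along every sequence of ground states of V_p the fraction of atoms
that are NOT [at distance ≥ 1−η from every other atom, with exactly twelve others within 1+η and
none at distance in (1+η, 1.26)] tends to 0. Inputs: a soft coordination cap (≤ 12 in the well:
Musin–Tarasov's strong thirteen-spheres theorem, a certified Bachoc–Vallentin-type semidefinite
bound, or the tree's computer-assisted `flyspeck_L12` once it carries a `_holds` — none is imported
by this route; take it at proof time as a PROVED fact or a certified computation, never as an item
hypothesis), tail bounds Σ_(r≥1.2)|V_p| = O(1.2⁻ᵖ/p), relaxed-hcp trial energy; the o(N) conclusion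
is where a V₃-free coercive estimate is needed. Used by the rung at η = min(η₀, η₁) ≤ 1/100 — after
the decahedral lesson expect η₀ < 0.0067. [difficulty: XL] -/
@[route_item "route-AtomisticToContinuum-BrittleRungDescent", crux]
def MieSoftKissing : Prop :=
  ∀ η : ℝ, 0 < η → η ≤ 1 / 100 → ∃ p₀ : ℕ, ∀ p : ℕ, p₀ ≤ p → ∀ x : (N : ℕ) → (Fin N → EuclideanSpace ℝ (Fin 3)), (∀ N, Literature.MathematicalPhysics.StatisticalMechanics.IsGroundState (Literature.MathematicalPhysics.StatisticalMechanics.miePotential p) (x N)) → Filter.Tendsto (fun N : ℕ => (Nat.card {i : Fin N // ¬ ((∀ j : Fin N, j ≠ i → (1 - η) ≤ dist (x N i) (x N j) ∧ (dist (x N i) (x N j) ≤ (1 + η) ∨ 63 / 50 ≤ dist (x N i) (x N j))) ∧ Nat.card {j : Fin N // j ≠ i ∧ dist (x N i) (x N j) ≤ (1 + η)} = 12)} : ℝ) / N) Filter.atTop (nhds 0)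

/-- item stmt-AtomisticToContinuum-9206 · crux · rank 4 · open · by planner
why it might fail: p=6 is not brittle: strain 1/400 costs ~2e-5/bond, the order of the hcp-fcc gap 7.2e-5/atom, so fault control in finite LJ ground states may fail; HasPeriodicGroundStateEnergy needs LJ's optimal stacking periodic (Hagg domination at p=6: uncertified sums); r^-6 tail outside all localized classes.
sources: FlatleyTheil2015, FrieseckeJamesMuller2002, Stillinger2001, PartayOrtnerCsanyi2017, BeterminSamajTravenec2022, Literature.Barriers.AtomisticToContinuum.ShortRangeStackingBlindness
[crux] BARLOW-TRUSS RIGIDITY AT p = 6 (the descent end of crux 2, explicit constants): if for some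
scale a > 0, along every sequence of Lennard-Jones ground states, all but o(N) atoms have a 4a-ball
in which every atom is softly twelve-kissed at scale a with tolerance 1/400 and gap 1.26a and has an
fcc/hcp-pattern soft contact graph on its shell, then `Crystallization` (the sub-problem statement
itself, both conjuncts for `lennardJones`). Same engine as crux 2 with the LJ numbers: J₂ ≈ −7.3e−5
< 0 with Hägg margin ≈ 250–450 (numerics of the retired CrystalKissingRigidity; certified J_k are
item 0670), octet-truss Korn constant versus the r⁻⁶ tail Hessian; ground states exist and are
1/3-separated by the PROVED `LennardJonesGroundStatesExist_holds` /
`LennardJonesMinimalDistance_holds`. [deps: BrittleBarlowRigidity] [difficulty: open-problem] -/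
@[route_item "route-AtomisticToContinuum-BrittleRungDescent", crux]
def LJBarlowRigidity : Prop :=
  (∃ a : ℝ, 0 < a ∧ ∀ x : (N : ℕ) → (Fin N → EuclideanSpace ℝ (Fin 3)), (∀ N, Literature.MathematicalPhysics.StatisticalMechanics.IsGroundState Literature.MathematicalPhysics.StatisticalMechanics.lennardJones (x N)) → Filter.Tendsto (fun N : ℕ => (Nat.card {i : Fin N // ¬ ∀ j : Fin N, dist (x N i) (x N j) ≤ 4 * a → (((∀ l : Fin N, l ≠ j → a * (1 - 1 / 400) ≤ dist (x N j) (x N l) ∧ (dist (x N j) (x N l) ≤ a * (1 + 1 / 400) ∨ 63 / 50 * a ≤ dist (x N j) (x N l))) ∧ Nat.card {l : Fin N // l ≠ j ∧ dist (x N j) (x N l) ≤ a * (1 + 1 / 400)} = 12) ∧ ((∃ e : {k : Fin N // k ≠ j ∧ dist (x N j) (x N k) ≤ a * (1 + 1 / 400)} ≃ {q : EuclideanSpace ℝ (Fin 3) // q ∈ Literature.Geometry.DiscreteGeometry.fccKissingPattern}, ∀ k k' : {k : Fin N // k ≠ j ∧ dist (x N j) (x N k) ≤ a * (1 + 1 /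 400)}, k ≠ k' → (dist (x N k.1) (x N k'.1) ≤ a * (1 + 1 / 400) ↔ dist (e k).1 (e k').1 = 1)) ∨ (∃ e : {k : Fin N // k ≠ j ∧ dist (x N j) (x N k) ≤ a * (1 + 1 / 400)} ≃ {q : EuclideanSpace ℝ (Fin 3) // q ∈ Literature.Geometry.DiscreteGeometry.hcpKissingPattern}, ∀ k k' : {k : Fin N // k ≠ j ∧ dist (x N j) (x N k) ≤ a * (1 + 1 / 400)}, k ≠ k' → (dist (x N k.1) (x N k'.1) ≤ a * (1 + 1 / 400) ↔ dist (e k).1 (e k').1 = 1))))} : ℝ) / N) Filter.atTop (nhds 0)) → _root_.Crystallization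

/-- item stmt-AtomisticToContinuum-9207 · crux · rank 5 · open · by planner
why it might fail: False if a positive fraction of bulk LJ ground-state atoms is strained >0.25% or not 12-coordinated: decahedral motifs close at 0.67%, 13*V(1.0455)<12*V(1) at p=6 so second-shell pricing is needed; defect-sparse crystallinity of 3-D LJ ground states is unknown at ANY tolerance (hcp split ~1e-4 ok).
sources: stmt-AtomisticToContinuum-0750, BlancLewin2015, Hales2012, Literature.Barriers.AtomisticToContinuum.IcosahedralClusters, Literature.Barriers.AtomisticToContinuum.TetrahedralFrustration, Literature.Barriers.AtomisticToContinuum.DecahedralSoftShell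
[crux] LJ SOFT KISSING WITH A 0.25 % BOND SPREAD (card B5(a), the p = 6 constant K1_6, sharpened by
the decahedral lesson): there is a scale a > 0 such that along every sequence of Lennard-Jones
ground states the fraction of atoms NOT [at distance ≥ (399/400)a from all others, exactly twelve
within (401/400)a, none in ((401/400)a, 1.26a)] tends to 0. Two-sided (strain) control that the
predecessor statements 0750 (no lower annulus bound) and TwoCentreKissing's BondOrderTwelve (no gap,
tolerance 10⁻³) do not give in this form; mechanism: second-shell pricing (card
link-census-gauss-bonnet-3d) since one-shell accounting fails at p = 6, elastic decay away from the
o(N) defects, the N^(−1/3) Laplace strain, and a relaxed-hcp nearest-neighbour split below 0.5 %.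
[difficulty: open-problem] -/
@[route_item "route-AtomisticToContinuum-BrittleRungDescent", crux]
def LJBondSpread : Prop :=
  ∃ a : ℝ, 0 < a ∧ ∀ x : (N : ℕ) → (Fin N → EuclideanSpace ℝ (Fin 3)), (∀ N, Literature.MathematicalPhysics.StatisticalMechanics.IsGroundState Literature.MathematicalPhysics.StatisticalMechanics.lennardJones (x N)) → Filter.Tendsto (fun N : ℕ => (Nat.card {i : Fin N // ¬ ((∀ j : Fin N, j ≠ i → a * (1 - 1 / 400) ≤ dist (x N i) (x N j) ∧ (dist (x N i) (x N j) ≤ a * (1 + 1 / 400) ∨ 63 / 50 * a ≤ dist (x N i) (x N j))) ∧ Nat.card {j : Fin N // j ≠ i ∧ dist (x N i) (x N j) ≤ a * (1 + 1 / 400)} = 12)} : ℝ) / N) Filter.atTop (nhds 0)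

/-- item stmt-AtomisticToContinuum-9208 · crux · rank 6 · open · by planner
why it might fail: Effective Hales Thm 3/Lemma 9 at tolerance 1/400, stability margins unknown: the decahedral five-ring closes only at eta>=0.0067 (margin 0.023 at 1/400), but other non-FCC/HCP soft shells (degree-3 nodes, 23 contacts, strained tame graphs of Lemma 8; DecahedralSoftShell caveat b) may close at 0.25%.
sources: Hales2012, Literature.Barriers.AtomisticToContinuum.DecahedralSoftShell, Summit.AtomisticToContinuum.Crystallization.Theorems.BrittleMieDescentEffectiveLocalHales_refuted, KusnerKusnerLagariasShlosman2018, BoroczkySzabo2016, FlatleyTheil2015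
[crux] EFFECTIVE LOCAL HALES AT RADIUS 2, TOLERANCE 1/400 (card B5(b), the p = 6 constant η₀; pure
metric geometry, scale 1): if u ∈ S ⊂ ℝ³ and every point of S within 401/400 of u (u and its soft
neighbours) is softly twelve-kissed with tolerance 1/400 (all other points at distance ≥ 399/400,
exactly twelve within 401/400, none in (401/400, 1.26)), then the soft contact graph (pairs within
401/400) on the twelve neighbours of u is isomorphic to the contact graph of the fcc pattern or of
the hcp pattern (tree `fccKissingPattern`/`hcpKissingPattern`, contacts at distance 1). RESTATEMENT
of the refuted EffectiveLocalHales (tolerance 1/100; witness: the D₅ₕ decahedral shell, five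
strained tetrahedra around a bond, which closes iff (2 sin 36°)²((1−η)² − (1+η)²/4) ≤ (1+η)², i.e. η
≥ η⋆ ≈ 0.0067; at η = 1/400 the left side exceeds the right by 0.023). The η → 0 version is
SoftLocalHales (support, compactness); this is its effectivisation, a semialgebraic statement
checkable Flyspeck-style by mining the margins of Hales's Lemma 9 exclusions and Lemma 10's rigidity
(tree KissingRigidity.lean, TameContactGraphs.lean) together with the closure inequalities of the
strained polytetrahedral fam -/
@[route_item "route-AtomisticToContinuum-BrittleRungDescent", crux]
def LocalHalesKernel : Prop :=
  ∀ (S : Set (EuclideanSpace ℝ (Fin 3))) (u : EuclideanSpace ℝ (Fin 3)), u ∈ S → (∀ v ∈ S, dist u v ≤ 1 + 1 / 400 → ((∀ w ∈ S, w ≠ v → 1 - 1 / 400 ≤ dist v w ∧ (dist v w ≤ 1 + 1 / 400 ∨ 63 / 50 ≤ dist v w)) ∧ {w ∈ S | w ≠ v ∧ dist v w ≤ 1 + 1 / 400}.ncard = 12)) → ((∃ e : {w : EuclideanSpace ℝ (Fin 3) // w ∈ S ∧ w ≠ u ∧ dist u w ≤ 1 + 1 / 400} ≃ {q : EuclideanSpace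 ℝ (Fin 3) // q ∈ Literature.Geometry.DiscreteGeometry.fccKissingPattern}, ∀ w w' : {w : EuclideanSpace ℝ (Fin 3) // w ∈ S ∧ w ≠ u ∧ dist u w ≤ 1 + 1 / 400}, w ≠ w' → (dist w.1 w'.1 ≤ 1 + 1 / 400 ↔ dist (e w).1 (e w').1 = 1)) ∨ (∃ e : {w : EuclideanSpace ℝ (Fin 3) // w ∈ S ∧ w ≠ u ∧ dist u w ≤ 1 + 1 / 400} ≃ {q : EuclideanSpace ℝ (Fin 3) // q ∈ Literature.Geometry.DiscreteGeometry.hcpKissingPattern}, ∀ w w' : {w : EuclideanSpace ℝ (Fin 3) // w ∈ S ∧ w ≠ u ∧ dist u w ≤ 1 + 1 / 400}, w ≠ w' → (dist w.1 w'.1 ≤ 1 + 1 / 400 ↔ dist (e w).1 (e w').1 = 1)))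

-- earlier SoftLocalHales (stmt-AtomisticToContinuum-9209, replaced 2026-08-15T16:32:33Z -> stmt-AtomisticToContinuum-10944): retired by None — Literature.Geometry.DiscreteGeometry.Hales2012_contactGraphFccOrHcp → ∃ η₀ : ℝ, 0 < η₀ ∧ ∀ η : ℝ, 0 < η → η ≤ η₀ → ∀ (S : Set (EuclideanSpace ℝ (Fin 3))) (u : EuclideanSpace ℝ (Fin 3)), u ∈ S → (∀ v ∈ S, dist u v ≤ 1 + η → ((∀ w ∈ S, w ≠ v → 1 - η ≤ dist v w 
/-- item stmt-AtomisticToContinuum-10944 · support · rank 9 · closed · proved by Summit.AtomisticToContinuum.Crystallization.Theorems.SoftLocalHales_proof (prover) · by planner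
sources: Hales2012, FlatleyTheil2015
[support] SOFT LOCAL HALES (card B2+(3); qualitative shadow of LocalHalesKernel; rev 3 of item
4147/9209: stated UNCONDITIONALLY — the former hypothesis `Hales2012_contactGraphFccOrHcp` is an
unproved computer-assisted Literature fact and is neither assumed nor imported by this route): there
is η₀ > 0 such that for all η ∈ (0, η₀] the conclusion of LocalHalesKernel holds with 1/400 replaced
by η (same hypothesis shape: u and every point of S within 1+η of u softly twelve-kissed with
tolerance η and gap 63/50). Proofs: (i) PRIMARY — from LocalHalesKernel with η₀ = 1/400, pure
bookkeeping: below the gap the dichotomy `dist ≤ 1+η ∨ 63/50 ≤ dist` at u and at its neighbours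
makes the neighbour sets and the soft contact graphs at tolerance η and at 1/400 coincide on these
thirteen atoms, so the 1/400 conclusion transports (the subtypes differ only in the tolerance; move
the bijection along the obvious Equiv); (ii) STAND-ALONE — from Hales 2012 Theorem 3 + Lemma 9,
printed for ALL V ∈ 𝒱 (arXiv:1209.6043, Definition 1 p. 2, Theorem 3 p. 11, Lemma 9 p. 13), by
compactness: counterexamples with η_n → 0 have boundedly many points within 2.3 of u (packing);
extract a convergent subsequence; by -/
@[route_item "route-AtomisticToContinuum-BrittleRungDescent", crux]
def SoftLocalHales : Prop :=
  ∃ η₀ : ℝ, 0 < η₀ ∧ ∀ η : ℝ, 0 < η → η ≤ η₀ → ∀ (S : Set (EuclideanSpace ℝ (Fin 3))) (u : EuclideanSpace ℝ (Fin 3)), u ∈ S → (∀ v ∈ S, dist u v ≤ 1 + η → ((∀ w ∈ S, w ≠ v → 1 - η ≤ dist v w ∧ (dist v w ≤ 1 + η ∨ 63 / 50 ≤ dist v w)) ∧ {w ∈ S | w ≠ v ∧ dist v w ≤ 1 + η}.ncard = 12)) → ((∃ e : {w : EuclideanSpace ℝ (Fin 3) // w ∈ S ∧ w ≠ u ∧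 dist u w ≤ 1 + η} ≃ {q : EuclideanSpace ℝ (Fin 3) // q ∈ Literature.Geometry.DiscreteGeometry.fccKissingPattern}, ∀ w w' : {w : EuclideanSpace ℝ (Fin 3) // w ∈ S ∧ w ≠ u ∧ dist u w ≤ 1 + η}, w ≠ w' → (dist w.1 w'.1 ≤ 1 + η ↔ dist (e w).1 (e w').1 = 1)) ∨ (∃ e : {w : EuclideanSpace ℝ (Fin 3) // w ∈ S ∧ w ≠ u ∧ dist u w ≤ 1 + η} ≃ {q : EuclideanSpace ℝ (Fin 3) // q ∈ Literature.Geometry.DiscreteGeometry.hcpKissingPattern}, ∀ w w' : {w : EuclideanSpace ℝ (Fin 3) // w ∈ S ∧ w ≠ u ∧ dist u w ≤ 1 + η}, w ≠ w' → (dist w.1 w'.1 ≤ 1 + η ↔ dist (e w).1 (e w').1 = 1)))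

-- earlier LadderGroundStates (stmt-AtomisticToContinuum-9212, replaced 2026-08-15T16:32:33Z -> stmt-AtomisticToContinuum-10945): retired by None — ∃ q₀ : ℕ, ∀ q : ℕ, q₀ ≤ q → (∀ N : ℕ, ∃ x : Fin N → EuclideanSpace ℝ (Fin 3), Literature.MathematicalPhysics.StatisticalMechanics.IsGroundState (Literature.Barriers.AtomisticToContinuum.mieWith (1 / (2 * (q : ℝ))) (1 / (q : ℝ)) (2 * q) q) x) ∧ (∀ (N : ℕ) 
/-- item stmt-AtomisticToContinuum-10945 · support · rank 9 · closed · proved by Summit.AtomisticToContinuum.Crystallization.Theorems.LadderGroundStates_proof @ f667b2aa9262 (prover) · by planner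
sources: BlancLewin2015, stmt-AtomisticToContinuum-3623, LennardJonesClusters.lean
[support] GROUND STATES ON THE (2q,q) LADDER EXIST AND ARE (1 − 2/q)-SEPARATED for q ≥ q₀ — the
claim of item stmt-AtomisticToContinuum-3623 (and 9212) written over `miePotential q` (rev 3;
definitionally equal to the `mieWith` form): Blanc–Lewin §1.2 binding criterion as in the tree's
PROVED `LennardJonesGroundStatesExist_holds`; Xue/Blanc removal-plus-packing as in
`LennardJonesMinimalDistance_holds` (LennardJonesClusters.lean — import it in the Theorems file; the
route file deliberately does not). RungAssembly consumes existence and separation from it.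
[difficulty: M] -/
@[route_item "route-AtomisticToContinuum-BrittleRungDescent", crux]
def LadderGroundStates : Prop :=
  ∃ q₀ : ℕ, ∀ q : ℕ, q₀ ≤ q → (∀ N : ℕ, ∃ x : Fin N → EuclideanSpace ℝ (Fin 3), Literature.MathematicalPhysics.StatisticalMechanics.IsGroundState (Literature.MathematicalPhysics.StatisticalMechanics.miePotential q) x) ∧ (∀ (N : ℕ) (x : Fin N → EuclideanSpace ℝ (Fin 3)), Literature.MathematicalPhysics.StatisticalMechanics.IsGroundState (Literature.MathematicalPhysics.StatisticalMechanics.miePotential q) x → ∀ i j : Fin N, i ≠ j → (1 - 2 / (q : ℝ)) ≤ dist (x i) (x j))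

-- earlier MieRung (stmt-AtomisticToContinuum-9213, replaced 2026-08-15T16:32:33Z -> stmt-AtomisticToContinuum-10946): retired by None — ∃ q₀ : ℕ, ∀ q : ℕ, q₀ ≤ q → Literature.MathematicalPhysics.StatisticalMechanics.HasPeriodicGroundStateEnergy (Literature.Barriers.AtomisticToContinuum.mieWith (1 / (2 * (q : ℝ))) (1 / (q : ℝ)) (2 * q) q) 3 ∧ Literature.MathematicalPhysics.StatisticalMechanics.IsCrys
/-- item stmt-AtomisticToContinuum-10946 · support · rank 9 · open · by planner
sources: FlatleyTheil2015, BlancLewin2015, stmt-AtomisticToContinuum-3624, arXiv:2204.12892, arXiv:2604.19239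
[support] THE BRITTLE RUNG (milestone; card headline; the claim of item
stmt-AtomisticToContinuum-3624 (and 9213) written over `miePotential q`, rev 3): there is q₀ such
that for all q ≥ q₀, HasPeriodicGroundStateEnergy V_q 3 ∧ IsCrystallizing V_q 3 — both Blanc–Lewin
conjuncts for the Mie (2q,q) potential in ℝ³, Flatley–Theil without V₃ (conclusion relaxed hcp).
Closed here by RungAssembly; a hypothesis of `closes` like every item, but not used by its proof.
[difficulty: open-problem] -/
@[route_item "route-AtomisticToContinuum-BrittleRungDescent", crux]
def MieRung : Prop :=
  ∃ q₀ : ℕ, ∀ q : ℕ, q₀ ≤ q → Literature.MathematicalPhysics.StatisticalMechanics.HasPeriodicGroundStateEnergy (Literature.MathematicalPhysics.StatisticalMechanics.miePotential q) 3 ∧ Literature.MathematicalPhysics.StatisticalMechanics.IsCrystallizing (Literature.MathematicalPhysics.StatisticalMechanics.miePotential q) 3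

-- earlier RungAssembly (stmt-AtomisticToContinuum-9214, replaced 2026-08-15T16:32:33Z -> stmt-AtomisticToContinuum-10947): retired by None — SoftLocalHales → Literature.Geometry.DiscreteGeometry.Hales2012_contactGraphFccOrHcp → LadderGroundStates → MieSoftKissing → BrittleBarlowRigidity → MieRung
/-- item stmt-AtomisticToContinuum-10947 · support · rank 9 · closed · proved by Summit.AtomisticToContinuum.Crystallization.Theorems.brittleRungDescent_rungAssembly_proof @ 614fa71ac06a (prover) · by planner
sources: Hales2012, FlatleyTheil2015
[support] glue for the rung (rev 3 of item 4149/9214: no Literature hypothesis in the chain),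
`SoftLocalHales → LadderGroundStates → MieSoftKissing → BrittleBarlowRigidity → MieRung`:
SoftLocalHales gives η₀; BrittleBarlowRigidity gives η₁ ≤ 1/100 and p₁; take η = min(η₀, η₁) ≤
1/100; MieSoftKissing gives p₀(η); soft kissing and the shell graphs are monotone in the tolerance
below the gap (η ≤ η₁ < 0.26: the dichotomy makes the neighbour sets at η and η₁ coincide); atoms
whose 7-ball contains a non-η-kissed atom number ≤ C·#(non-kissed) by packing (separation 1 − 2/q
from LadderGroundStates), hence o(N); every other atom has a 4-ball of η₁-kissed atoms whose shell
graphs SoftLocalHales supplies (all points within 1+η of such an atom are η-kissed);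
BrittleBarlowRigidity applies for p ≥ max(p₀(η), p₁, q₀) with existence from LadderGroundStates.
[difficulty: provable-now] -/
@[route_item "route-AtomisticToContinuum-BrittleRungDescent", crux]
def RungAssembly : Prop :=
  SoftLocalHales → LadderGroundStates → MieSoftKissing → BrittleBarlowRigidity → MieRung

/-- item stmt-AtomisticToContinuum-9210 · support · rank 9 · closed · proved by Summit.AtomisticToContinuum.Crystallization.Theorems.softLayerPropagation @ 58e7477d3404 (prover) · by planner
sources: HalesDSP2012, Hales2012
[support] SOFT LAYER PROPAGATION (qualitative local form of the PROVED
`HalesDSP_layerPackings_holds`; same text as item 4148): for every R ≥ 4 and δ > 0 there is η > 0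
such that if every point of S in the R-ball about c is softly twelve-kissed (tolerance η, gap 1.26)
with an fcc/hcp soft contact graph, then S in the R/2-ball is δ-close to a rigid-motion image of a
Barlow stacking `barlowStacking 1 √(2/3) s`, `IsHaggSeq s`. By compactness from the exact local
statement (LayerPropagation/LayerStackings.lean arguments are local). The effective octet-truss
version rides with the rigidity cruxes (`--supports`). [difficulty: M] -/
@[route_item "route-AtomisticToContinuum-BrittleRungDescent", crux]
def SoftLayerPropagation : Prop :=
  ∀ R : ℝ, 4 ≤ R → ∀ δ : ℝ, 0 < δ → ∃ η : ℝ, 0 < η ∧ ∀ (S : Set (EuclideanSpace ℝ (Fin 3))) (c : EuclideanSpace ℝ (Fin 3)), (∀ v ∈ S, dist v c ≤ R → ((∀ w ∈ S, w ≠ v → 1 - η ≤ dist v w ∧ (dist v w ≤ 1 + η ∨ 63 / 50 ≤ dist v w)) ∧ {w ∈ S | w ≠ v ∧ dist v w ≤ 1 + η}.ncard = 12) ∧ ((∃ e : {w : EuclideanSpace ℝ (Fin 3) // w ∈ S ∧ w ≠ v ∧ dist v w ≤ 1 + η} ≃ {q : EuclideanSpace ℝ (Fin 3) // q ∈ Literature.Geometry.DiscreteGeometry.fccKissingPattern},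 ∀ w w' : {w : EuclideanSpace ℝ (Fin 3) // w ∈ S ∧ w ≠ v ∧ dist v w ≤ 1 + η}, w ≠ w' → (dist w.1 w'.1 ≤ 1 + η ↔ dist (e w).1 (e w').1 = 1)) ∨ (∃ e : {w : EuclideanSpace ℝ (Fin 3) // w ∈ S ∧ w ≠ v ∧ dist v w ≤ 1 + η} ≃ {q : EuclideanSpace ℝ (Fin 3) // q ∈ Literature.Geometry.DiscreteGeometry.hcpKissingPattern}, ∀ w w' : {w : EuclideanSpace ℝ (Fin 3) // w ∈ S ∧ w ≠ v ∧ dist v w ≤ 1 + η}, w ≠ w' → (dist w.1 w'.1 ≤ 1 + η ↔ dist (e w).1 (e w').1 = 1)))) → ∃ (s : ℤ → ℤ) (g : EuclideanSpace ℝ (Fin 3) ≃ᵃⁱ[ℝ] EuclideanSpace ℝ (Fin 3)), Literature.MathematicalPhysics.StatisticalMechanics.IsHaggSeq s ∧ ∀ v ∈ S, dist v c ≤ R / 2 → ∃ z ∈ Literature.MathematicalPhysics.StatisticalMechanics.barlowStacking 1 (Real.sqrt (2 / 3)) s, dist v (g z) ≤ δ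

/-- item stmt-AtomisticToContinuum-9211 · support · rank 9 · closed · proved by Summit.AtomisticToContinuum.Crystallization.Theorems.LJKissingBalls_proof @ 3c3867751c78 (prover) · by planner
sources: BlancLewin2015, LennardJonesClusters.lean
[support] LJ BOOKKEEPING GLUE (provable now): LocalHalesKernel → LJBondSpread → [the hypothesis of
LJBarlowRigidity]: rescale by a⁻¹; an atom all of whose soft neighbours are softly kissed gets its
fcc/hcp shell graph from LocalHalesKernel; by the PROVED `LennardJonesMinimalDistance_holds` (δ =
1/3) a 7a-ball holds ≤ C atoms, so the atoms whose 7a-ball meets a non-kissed atom number ≤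
C·#(non-kissed) = o(N); every other atom has a 4a-ball of kissed atoms with shell graphs. This item
makes the deciding theorem pure logic: `closes … := h_R (h_glue h_G h_K)`. [difficulty:
provable-now] -/
@[route_item "route-AtomisticToContinuum-BrittleRungDescent", crux]
def LJKissingBalls : Prop :=
  LocalHalesKernel → LJBondSpread → (∃ a : ℝ, 0 < a ∧ ∀ x : (N : ℕ) → (Fin N → EuclideanSpace ℝ (Fin 3)), (∀ N, Literature.MathematicalPhysics.StatisticalMechanics.IsGroundState Literature.MathematicalPhysics.StatisticalMechanics.lennardJones (x N)) → Filter.Tendsto (fun N : ℕ => (Nat.card {i : Fin N // ¬ ∀ j : Fin N, dist (x N i) (x N j) ≤ 4 * a → (((∀ l : Fin N, l ≠ j → a * (1 - 1 / 400) ≤ dist (x N j) (x N l) ∧ (dist (x N j) (x N l) ≤ a * (1 + 1 / 400) ∨ 63 / 50 * a ≤ dist (x N j) (x N l))) ∧ Nat.card {l : Fin N // l ≠ j ∧ dist (x N j) (x N l) ≤ a * (1 + 1 / 400)} = 12) ∧ ((∃ e : {k : Fin N // k ≠ j ∧ dist (x N j) (x N k) ≤ a * (1 + 1 / 400)} ≃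 {q : EuclideanSpace ℝ (Fin 3) // q ∈ Literature.Geometry.DiscreteGeometry.fccKissingPattern}, ∀ k k' : {k : Fin N // k ≠ j ∧ dist (x N j) (x N k) ≤ a * (1 + 1 / 400)}, k ≠ k' → (dist (x N k.1) (x N k'.1) ≤ a * (1 + 1 / 400) ↔ dist (e k).1 (e k').1 = 1)) ∨ (∃ e : {k : Fin N // k ≠ j ∧ dist (x N j) (x N k) ≤ a * (1 + 1 / 400)} ≃ {q : EuclideanSpace ℝ (Fin 3) // q ∈ Literature.Geometry.DiscreteGeometry.hcpKissingPattern}, ∀ k k' : {k : Fin N // k ≠ j ∧ dist (x N j) (x N k) ≤ a * (1 + 1 / 400)}, k ≠ k' → (dist (x N k.1) (x N k'.1) ≤ a * (1 + 1 / 400) ↔ dist (e k).1 (e k').1 = 1))))} : ℝ) / N) Filter.atTop (nhds 0))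

-- earlier Assembly (stmt-AtomisticToContinuum-9215, replaced 2026-08-16T15:47:47Z -> stmt-AtomisticToContinuum-15633): proved by Summit.AtomisticToContinuum.Crystallization.Theorems.brittleRungDescent_assembly_proof @ 826e0010fde4 — LocalHalesKernel → LJBondSpread → LJKissingBalls → LJBarlowRigidity → _root_.Crystallization
/-- item stmt-AtomisticToContinuum-15633 · assembly · rank 1 · closed · proved by Summit.AtomisticToContinuum.Crystallization.Theorems.brittleRungDescent_assembly_proof @ b51bfe74d739 (prover) · by planner
sources: BlancLewin2015, Hales2012
[assembly] LocalHalesKernel → LJBondSpread → LJBarlowRigidity → Crystallization (the sub-problem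
Statement decl `_root_.Crystallization`): the three Lennard-Jones-end cruxes (effective local Hales
at radius 2 and tolerance 1/400; LJ soft kissing with a 0.25 % bond spread; Barlow-truss rigidity at
p = 6) decide the sub-problem, with the bookkeeping glue LJKissingBalls
(stmt-AtomisticToContinuum-9211, PROVED: Theorems/BrittleRungDescentLJKissingBalls.lean,
`Summit.AtomisticToContinuum.Crystallization.Theorems.LJKissingBalls_proof`) DISCHARGED. Restated
2026-08-16 (route-repair, ground-failed) from the rev-0 form `LocalHalesKernel → LJBondSpread →
LJKissingBalls → LJBarlowRigidity → Crystallization` (stmt-AtomisticToContinuum-9215,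
closed·proved), which is the type of `closes` re-curried and hence a propositional tautology once
the implication-shaped items LJKissingBalls (`LocalHalesKernel → LJBondSpread → H`) and
LJBarlowRigidity (`H → Crystallization`) are unfolded (ground.trivial: tauto). The restated form
carries the real content "cruxes ⇒ sub-problem". Provable now, one line in a Theorems file importing
`Summits.AtomisticToContinuum.Crystallization.Theorems.BrittleRungDescentLJKi -/
@[route_item "route-AtomisticToContinuum-BrittleRungDescent", crux]
def Assembly : Prop :=
  LocalHalesKernel → LJBondSpread → LJBarlowRigidity → _root_.Crystallization

/-! D-0027 §2.1 — DECIDING THEOREM (planner-authored via `route open/edit --closes-file`; by planner-plancard-AtomisticToContinuum-Crystal-007228c5-0 2026-08-15T13:57:46Z):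
its hypotheses are this route's items and its conclusion the sub-problem Statement (glue_lint), and it elaborates with this file. -/

@[closes "route-AtomisticToContinuum-BrittleRungDescent"] theorem closes : BrittleBarlowRigidity → MieSoftKissing → LJBarlowRigidity → LJBondSpread → LocalHalesKernel → SoftLocalHales → SoftLayerPropagation → LJKissingBalls → LadderGroundStates → MieRung → RungAssembly → Assembly → _root_.Crystallization := by intros; exact (‹LJBarlowRigidity› : LJBarlowRigidity) ((‹LJKissingBalls› : LJKissingBalls) ‹LocalHalesKernel› ‹LJBondSpread›)

end Summit.AtomisticToContinuum.Crystallization.Theses.BrittleRungDescent
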